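import Literature.NumberTheory.EllipticCurves.ModularDegreeQuadraticTwistSemistableProofs
import Summits.BirchSwinnertonDyer.Rank1Residual.O5.CongruenceNumberTwist
import HarnessLib

/-!
# O5 (`9 ∣ N`): the `3`-adic DEGREE JUMP under the `(−3)`-twist at a GOOD / MULTIPLICATIVE `3`
# (Watkins' `V₃ = 2(4 − a₃)(4 + a₃)` resp. `8`) — the `hjm` input of `O5.law_iff_twistJump_of_jm`, as THEOREMS

HONEST FRAMING (cell `b2b-bsdres`, run/shared/lean/b2b/bsd-rank1-residual/, verbatim in every
file): the goal of the cell is to DELETE the COMBINATION-SHAPED residual classes of the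
Birch–Swinnerton-Dyer formula for ALL analytic-rank `≤ 1` elliptic curves over `ℚ` — assembled
STRICTLY from published theorems — so that the rank-`≤ 1` remainder becomes exactly the
CONSTRUCTION-SHAPED classes, which are TYPED, NOT attempted. This is not "finishing BSD". Lane
CLASS-CLOSURE, team o5 (`9 ∥ N`); planner o5-r2 GEN 7 (G7-1 M-TW / G7-3 reduction) / typer cc-typer-5
GEN 7–9 (`O5/CongruenceNumberTwist.lean` §4 `law_iff_twistJump_of_jm`, binder `hjm`); prover seat
`b2b-bsdres-x11b3-p5` (gen. 8, cross-cell pool item W42; harvest-2 GEN 43 / cc-typer-5 GEN 9: no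
objection). THEOREMS ONLY; nothing booked; no RESIDUAL-MAP mark / label / count moved; O5 OPEN; the
`@[conjecture]` nodes `CongruenceNumberTwistJumpAtNine` (R-TW), `CongruenceDefectFlatTwinAtNine` (R-FLAT),
`CongruenceDefectLawAtNine` (E-O5-CONG) are UNTOUCHED and NOT discharged; o5-r2's 458 427-pair M-TW
census stays EVIDENCE.

## What

M-TW (o5-r2 GEN 7 N1, Watkins 2002 §2.1) is now a THEOREM of the tree at EVERY reduction type of the
`3`-semistable partner: the additive twin case `V_p = p` is `ModularDegreeQuadraticTwistProofs` (E63/E64),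
the good / multiplicative cases `V_p = (p − 1)((p + 1)² − a_p²)` / `p² − 1` are
`ModularDegreeQuadraticTwistSemistableProofs` (this seat, Literature, all odd `p`). This file reads the
latter `3`-adically at `p = 3`, in the shape consumed by `law_iff_twistJump_of_jm` (`hjm : ord₃ m_W =
ord₃ m_G + jm`):

* `padicValNat_modularDegree_twist_three_of_hasGoodReductionAtPrime`: `G = W` good at `3`,
  `W' = C • (W ⊗ χ₋₃)` additive at `3`, `|u(C)| = 1`, data at levels `M` (`3 ∤ M`) and `N = 9M`,
  `|c| = |c'|` ⟹ `ord₃ m_{W'} = ord₃ m_W + 1` if `3 ∤ a₃(W)` (ORDINARY: `V₃ ∈ {30, 24}`), `+ 0` if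
  `3 ∣ a₃(W)` (SUPERSINGULAR: `V₃ ∈ {32, 14}`; `a₃ ∈ {−3,…,3}` by Hasse) — `jm = 1` on `I₀*`-ord,
  `jm = 0` on `I₀*`-ss, matching o5-r2's census split (56 349 / 29 619 rows);
* `padicValNat_modularDegree_twist_three_of_hasMultiplicativeReductionAtPrime`: `W` multiplicative at
  `3`, levels `M` (`3 ∣ M`) and `N = 3M` ⟹ `ord₃ m_{W'} = ord₃ m_W` (`V₃ = 8`; `jm = 0` on `Iₙ*`,
  263 597 rows).

`|c| = |c'|` and `|u| = 1` are explicit hypotheses, as in cc-typer-5's §2 (`padicValNat_deg_twin_eq_add_one`);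
no node / definition / tag is introduced or edited here (a node `ModularDegreeTwistJumpAtNine`, if
wanted, is the typer's pen — cc-typer-5 GEN 9: not typed; a doc pointer in §4 instead).

References: [Watkins2002] M. Watkins, Experiment. Math. 11 (2002) §2.1 p. 491; [SilvermanAEC2009] V.1
Thm. 1.1 (Hasse); cell files `HOME/b2b-bsdres-o5-r2/gen7/O5-GEN7.md` (G7-1, G7-3),
`class-closure/O5/TYPED.md` §11–§12.
-/

set_option autoImplicit false

noncomputable section

open scoped Classical

namespace Summit.BirchSwinnertonDyer.Rank1Residual.O5

open WeierstrassCurve Literature.NumberTheory.EllipticCurves.Rank1Residual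
  Literature.NumberTheory.EllipticCurves.ModularForms

section JumpThree

variable {W W' : WeierstrassCurve ℚ} [W.IsElliptic] [W'.IsElliptic] {M N : ℕ} [NeZero M] [NeZero N]

/-- `p* = −3` at `p = 3`, in the form of `ModularDegreeQuadraticTwistProofs`. [folklore] -/
theorem pStar_intCast_three : ((((-1 : ℤ) ^ (3 / 2) * (3 : ℕ) : ℤ)) : ℚ) = -3 := by norm_num

omit [W'.IsElliptic] in
/-- **Hasse at `3`**: `a₃(W)² ≤ 12`, i.e. `a₃(W) ∈ {−3, …, 3}`. [cite: SilvermanAEC2009, V.1 Thm. 1.1 (Hasse)] -/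
theorem sq_LFunction_three_le : W.LFunction 3 ^ 2 ≤ 12 := by
  haveI : Fact (Nat.Prime 3) := ⟨Nat.prime_three⟩
  have h := sq_LFunction_prime_le W 3
  norm_num at h
  have h' : ((W.LFunction 3 ^ 2 : ℤ) : ℝ) ≤ 12 := by push_cast; linarith
  exact_mod_cast h'

/-- `ord₃ (3k · d) = ord₃ d + 1` for `3 ∤ k`. [folklore] -/
private theorem padicValNat_three_mul_mul {k d : ℕ} (hk : ¬ 3 ∣ k) (hd : d ≠ 0) :
    padicValNat 3 (3 * k * d) = padicValNat 3 d + 1 := by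
  have hk0 : k ≠ 0 := by rintro rfl; exact hk (dvd_zero 3)
  rw [padicValNat.mul (by positivity) hd, padicValNat.mul (by norm_num) hk0, padicValNat_self,
    padicValNat.eq_zero_of_not_dvd hk]
  ring

/-- `ord₃ (v · d) = ord₃ d` for `3 ∤ v`. [folklore] -/
private theorem padicValNat_mul_of_not_three_dvd {v d : ℕ} (hv : ¬ 3 ∣ v) (hd : d ≠ 0) :
    padicValNat 3 (v * d) = padicValNat 3 d := by
  have hv0 : v ≠ 0 := by rintro rfl; exact hv (dvd_zero 3)
  rw [padicValNat.mul hv0 hd, padicValNat.eq_zero_of_not_dvd hv, zero_add]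

/-- **The degree jump under the `(−3)`-twist at a prime of GOOD reduction, `p = 3`** (Watkins' `V₃ =
2(4 − a₃)(4 + a₃)` read `3`-adically — the `hjm` input of `O5.law_iff_twistJump_of_jm` on the `I₀*`
rows): let `W/ℚ` be elliptic with good reduction at `3`, `W' = C • (W ⊗ χ₋₃)` additive at `3` with
`|u(C)| = 1`, `D` a parametrisation datum of `W` at a level `M` with `3 ∤ M` and `D'` one of `W'` at
level `N = 9M`, with Manin constants of the same absolute value. Then `ord₃ m_{W'} = ord₃ m_W + 1` if
`3 ∤ a₃(W)` (ORDINARY: `V₃ ∈ {30, 24}`) and `ord₃ m_{W'} = ord₃ m_W` if `3 ∣ a₃(W)` (SUPERSINGULAR: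
`V₃ ∈ {32, 14}`). Nothing conjectural is used; `|c| = |c'|` is an explicit hypothesis (Watkins: "if we
assume the Manin constants are the same"). [cite: Watkins2002, §2.1 (p. 491)] -/
theorem padicValNat_modularDegree_twist_three_of_hasGoodReductionAtPrime
    (hgood : W.HasGoodReductionAtPrime 3) (C : VariableChange ℚ)
    (hW' : C • W.quadraticTwist (-3) = W') (hu : |(C.u : ℚ)| = 1) (hadd' : Addv W' 3)
    (D : ModularParametrizationData W M) (D' : ModularParametrizationData W' N)
    (hM : ¬ 3 ∣ M) (hN : N = 9 * M) (hc : D.c.natAbs = D'.c.natAbs) :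
    padicValNat 3 D'.modularDegree =
      padicValNat 3 D.modularDegree + (if (3 : ℤ) ∣ W.LFunction 3 then 0 else 1) := by
  have hW'' : C • W.quadraticTwist ((((-1 : ℤ) ^ (3 / 2) * (3 : ℕ) : ℤ)) : ℚ) = W' := by
    rw [pStar_intCast_three]; exact hW'
  have hW'0 : ∀ n : ℕ, 3 ∣ n → W'.LFunction n = 0 := fun n hn ↦
    W'.LFunction_apply_eq_zero_of_not_good_of_not_mult 3 hadd'.1 hadd'.2 hn
  have hmain := ModularParametrizationData.deg_mul_sq_eq_of_quadraticTwist_pStar_of_hasGoodReductionAtPrime_of_abs_u_eq_one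
    (W := W) (p := 3) (by norm_num) hgood C hW'' hu hW'0 D D' hM (by rw [hN]; norm_num)
  -- equal Manin constants up to sign, and `c ≠ 0`: `deg' = V₃ · deg`
  have hcsq : D.c ^ 2 = D'.c ^ 2 := by
    rcases Int.natAbs_eq_natAbs_iff.mp hc with h | h <;> simp [h]
  have hc0 : D.c ≠ 0 := D.maninConstant_ne_zero_holds
  have hcsq0 : D'.c ^ 2 ≠ 0 := by rw [← hcsq]; exact pow_ne_zero 2 hc0
  have ha := sq_LFunction_three_le (W := W)
  set a : ℤ := W.LFunction 3 with ha_def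
  have hdeg : (D'.deg : ℤ) = 2 * (16 - a ^ 2) * D.deg := by
    rw [hcsq] at hmain
    refine mul_right_cancel₀ hcsq0 ?_
    push_cast at hmain
    linear_combination hmain
  have hd0 : D.deg ≠ 0 := D.deg_pos.ne'
  show padicValNat 3 D'.deg = padicValNat 3 D.deg + _
  have hle : a ≤ 3 := by nlinarith
  have hge : -3 ≤ a := by nlinarith
  interval_cases a
  · -- a = -3: V = 14
    have h : D'.deg = 14 * D.deg := by omega
    rw [h, padicValNat_mul_of_not_three_dvd (by norm_num) hd0]; norm_num
  · -- a = -2: V = 24 = 3·8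
    have h : D'.deg = 3 * 8 * D.deg := by omega
    rw [h, padicValNat_three_mul_mul (by norm_num) hd0]; norm_num
  · -- a = -1: V = 30 = 3·10
    have h : D'.deg = 3 * 10 * D.deg := by omega
    rw [h, padicValNat_three_mul_mul (by norm_num) hd0]; norm_num
  · -- a = 0: V = 32
    have h : D'.deg = 32 * D.deg := by omega
    rw [h, padicValNat_mul_of_not_three_dvd (by norm_num) hd0]; norm_num
  · -- a = 1: V = 30
    have h : D'.deg = 3 * 10 * D.deg := by omega
    rw [h, padicValNat_three_mul_mul (by norm_num) hd0]; norm_num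
  · -- a = 2: V = 24
    have h : D'.deg = 3 * 8 * D.deg := by omega
    rw [h, padicValNat_three_mul_mul (by norm_num) hd0]; norm_num
  · -- a = 3: V = 14
    have h : D'.deg = 14 * D.deg := by omega
    rw [h, padicValNat_mul_of_not_three_dvd (by norm_num) hd0]; norm_num

/-- **The degree jump under the `(−3)`-twist at a prime of MULTIPLICATIVE reduction, `p = 3`**
(Watkins' `V₃ = 8`, a `3`-adic unit — the `hjm = 0` input of `O5.law_iff_twistJump_of_jm` on the `Iₙ*`
rows): `W` multiplicative at `3`, `W' = C • (W ⊗ χ₋₃)` additive at `3` with `|u(C)| = 1`, `D` at a level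
`M` with `3 ∣ M`, `D'` at level `N = 3M`, Manin constants of the same absolute value ⟹
`ord₃ m_{W'} = ord₃ m_W`. [cite: Watkins2002, §2.1 (p. 491)] -/
theorem padicValNat_modularDegree_twist_three_of_hasMultiplicativeReductionAtPrime
    (hmult : W.HasMultiplicativeReductionAtPrime 3) (C : VariableChange ℚ)
    (hW' : C • W.quadraticTwist (-3) = W') (hu : |(C.u : ℚ)| = 1) (hadd' : Addv W' 3)
    (D : ModularParametrizationData W M) (D' : ModularParametrizationData W' N)
    (hM : 3 ∣ M) (hN : N = 3 * M) (hc : D.c.natAbs = D'.c.natAbs) :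
    padicValNat 3 D'.modularDegree = padicValNat 3 D.modularDegree := by
  have hW'' : C • W.quadraticTwist ((((-1 : ℤ) ^ (3 / 2) * (3 : ℕ) : ℤ)) : ℚ) = W' := by
    rw [pStar_intCast_three]; exact hW'
  have hW'0 : ∀ n : ℕ, 3 ∣ n → W'.LFunction n = 0 := fun n hn ↦
    W'.LFunction_apply_eq_zero_of_not_good_of_not_mult 3 hadd'.1 hadd'.2 hn
  have hmain := ModularParametrizationData.deg_mul_sq_eq_of_quadraticTwist_pStar_of_hasMultiplicativeReductionAtPrime_of_abs_u_eq_one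
    (W := W) (p := 3) (by norm_num) hmult C hW'' hu hW'0 D D' hM hN
  have hcsq : D.c ^ 2 = D'.c ^ 2 := by
    rcases Int.natAbs_eq_natAbs_iff.mp hc with h | h <;> simp [h]
  have hc0 : D.c ≠ 0 := D.maninConstant_ne_zero_holds
  have hcsq0 : D'.c ^ 2 ≠ 0 := by rw [← hcsq]; exact pow_ne_zero 2 hc0
  have hdeg : (D'.deg : ℤ) = 8 * D.deg := by
    rw [hcsq] at hmain
    refine mul_right_cancel₀ hcsq0 ?_
    push_cast at hmain
    linear_combination hmain
  have hd0 : D.deg ≠ 0 := D.deg_pos.ne'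
  show padicValNat 3 D'.deg = padicValNat 3 D.deg
  have h : D'.deg = 8 * D.deg := by omega
  rw [h, padicValNat_mul_of_not_three_dvd (by norm_num) hd0]

end JumpThree

end Summit.BirchSwinnertonDyer.Rank1Residual.O5

end
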